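import Summits.BirchSwinnertonDyer.BirchSwinnertonDyer.Theorems.ByReductionTypeAtTwoAdditiveKatoTransportPrintExactAnyImageNonvanishing
import HarnessLib

/-!
# Route ByReductionTypeAtTwo, crux C4″ `AdditivePotMultOverKAtTwo` (stmt-BirchSwinnertonDyer-22618; parent
# `AdditiveRankZeroAtTwo` 19098) — R18, part 1b: the (−2)-block twin — the `χ₂`-twisted odd-branch multiple `L̃` EXISTS
# (`m = 0`) and `L̃ ≠ 0 ⟸ L(W, 1) ≠ 0` (theorems only)

Cell `bsd-2adic`, seat `bsd-2adic-k4-w3` GEN 6. Sequel of `…PrintExactAnyImageNonvanishing` for the (−2)-block door of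
p708200, whose DATA binder is `(Lt, m, hLt : ι Lt = 2^m · L⁻₂(f_{W″}, 1, ω·χ₂, T), hLt0 : Lt ≠ 0)` (`W″ ≅ W^{(−2)}` split
multiplicative at `2`, `f` its newform; the `χ₂`-TWISTED odd branch):

* `exists_dirichletCharacter_neg_eight` — the odd primitive quadratic `χ₋₈ = (−2/·)` mod `8` (tree
  `exists_dirichletCharacter_four_mul` at `m = −2`); `sum_univ_zmod_eight`.
* `ratMinusSymbolSum_eight_ne_zero_of_entireLFunction_ne_zero` — **`[1/8]⁻ + [3/8]⁻ − [5/8]⁻ − [7/8]⁻ ≠ 0 ⟸ L(W,1) ≠ 0`**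
  for `W ≅ W″^{(−2)}`, `W″` SEMISTABLE at `2`: `aₙ(W) = χ₋₈(n)aₙ(W″)` (part 1a §1 at `m = −2`), Birch for `χ₋₈` (tree
  `ratMinusTwistedSymbolSum_mul_minusPeriod_mul_I`), `τ(χ₋₈) ≠ 0` (`gaussSum_ne_zero`).
* `padicLFunctionMinusBranchMultTwist_ne_zero_of_entireLFunction_ne_zero` — **`L⁻₂(f_{W″}, 1, ω·χ₂, T) ≠ 0`**: its constant
  term IS that sum (`constantCoeff_padicLFunctionMinusBranchMultTwist_one_neg_one_two_of_split`, p710839 — the branch at the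
  character `χ₂` of `Γ`).
* `exists_iwasawa_lift_oddBranchTwist_ne_zero` — **`∃ L̃ ∈ Λ, ι L̃ = 2⁰·L⁻₂(…, ω·χ₂, T) ∧ L̃ ≠ 0`**: `L̃ := Tw₋₁ G`, the unit
  twist `(1+T) ↦ −(1+T)` of the integral lift of the untwisted branch (GEN 2's
  `iwasawaToPowerSeries_unitTwist_eq_mul_padicLFunctionMinusBranchMultTwist_of_newform`, `‖−1 − 1‖₂ < 1`).

HONEST FRAMING (D-0036 / D-0054): theorems only — no definition, no named fact, no instance, no `sorry`;
route-independent; CONDITIONAL only on `hasEntireLFunction_rat`; types-the-object-of; closes none; nothing booked; BSD is not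
proved by any of this. PARTITION: X5@2 additive potentially-multiplicative block, the (−2)-split-twist sub-blocks (30 + 9
classes) × `p = 2`.

References: [MazurTateTeitelbaum1986Invent] §I.8 (8.6), §I.10 (10.1), §I.12–I.14; [SilvermanAEC2009] X.2 with Exercise 10.16,
VII.5.4, §C.16; [Cox2013] §1.C Lemma 1.14; [GreenbergLNM1716] §1 (pp. 67–68); memo
`run/shared/lean/pub/bsd-2adic/k4w3/gen6/VERDICT-22618-k4w3-GEN6.md`.
-/

set_option autoImplicit false
-- the summit's namespace `Summit.BirchSwinnertonDyer.BirchSwinnertonDyer` (Sub = Summit) trips `dupNamespace`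
set_option linter.dupNamespace false

noncomputable section

open scoped Classical MatrixGroups ModularForm NumberField NumberTheorySymbols

open Field CongruenceSubgroup WeierstrassCurve IsDedekindDomain Rat.HeightOneSpectrum
  Literature.NumberTheory.EllipticCurves Literature.NumberTheory.EllipticCurves.ModularForms
  Literature.NumberTheory.EllipticCurves.IwasawaAlgebra Literature.NumberTheory.QuadraticFields
  Summit.BirchSwinnertonDyer.BirchSwinnertonDyer.Theorems

namespace Summit.BirchSwinnertonDyer.BirchSwinnertonDyer.Theorems.AddKatoTwo

/-! ## §3 The (−2)-block: Birch's formula for `χ₋₈`, `L⁻₂(f_{W″}, 1, ω·χ₂, T) ≠ 0`, and its integral lift -/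

/-- **The character `χ₋₈`**: an odd primitive Dirichlet character mod `8` with `χ(n) = (−2 / n)` for odd `n` and
`χ(n) = 0` for even `n` (the Kronecker character of `ℚ(√−2)`, `d_K = −8 = 4·(−2)`; tree `exists_dirichletCharacter_four_mul`
at `m = −2`). [cite: Cox2013, §1.C Lemma 1.14] -/
theorem exists_dirichletCharacter_neg_eight :
    ∃ χ : DirichletCharacter ℂ 8, χ.IsPrimitive ∧ χ.IsQuadratic ∧ χ.Odd ∧
      (∀ n : ℕ, χ n = if Even n then 0 else (J(-2 | n) : ℂ)) := by
  -- adapted from `AddDescentK.exists_dirichletCharacter_neg_four`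
  have hm0 : (-2 : ℤ) ≠ 0 := by norm_num
  have hm4 : (-2 : ℤ) % 4 = 2 ∨ (-2 : ℤ) % 4 = 3 := Or.inl (by decide)
  obtain ⟨χ, hχ⟩ := exists_dirichletCharacter_four_mul (-2) hm0
  haveI : NeZero (4 * (-2 : ℤ).natAbs) := ⟨by decide⟩
  have hev : ∀ n : ℕ, Even n → χ n = 0 := fun n hn ↦ by
    refine apply_eq_zero_of_even (m := -2) ?_
    rw [ZMod.val_natCast]
    have h8 : (4 * (-2 : ℤ).natAbs) = 8 := by decide
    rw [h8, Nat.even_iff, Nat.mod_mod_of_dvd n (by norm_num : 2 ∣ 8)]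
    exact Nat.even_iff.mp hn
  exact ⟨χ, isPrimitive_of_forall_odd hm4 Int.prime_two.neg.squarefree hχ, isQuadratic_of_forall_odd hm0 hχ,
    apply_neg_one_of_forall_odd (by norm_num) hm4 hχ, fun n ↦ by
      split_ifs with hn
      · exact hev n hn
      · exact hχ n (Nat.not_even_iff_odd.mp hn)⟩

/-- A sum over `ℤ/8` is the sum of its eight values. [folklore] -/
theorem sum_univ_zmod_eight {M : Type*} [AddCommMonoid M] (g : ZMod 8 → M) :
    ∑ a, g a = g 0 + g 1 + g 2 + g 3 + g 4 + g 5 + g 6 + g 7 :=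
  Fin.sum_univ_eight g

section NegTwo

variable (W W'' : WeierstrassCurve ℚ) [W.IsElliptic] [W''.IsElliptic]
  (hWtw : ∃ C : VariableChange ℚ, C • W''.quadraticTwist (-2) = W)
  {N : ℕ} [NeZero N] {f : CuspForm (Gamma0 N) 2} (hf : IsNewformOf W'' f)

include hWtw hf in
/-- **`[1/8]⁻_f + [3/8]⁻_f − [5/8]⁻_f − [7/8]⁻_f ≠ 0` whenever `L(W, 1) ≠ 0`**, for `W ≅ W″^{(−2)}` with `W″` SEMISTABLE at
`2` and `f` the newform of `W″`: the Dirichlet coefficients of `W` are `χ₋₈(n)·aₙ(f)` (§1, `m = −2`), the entire `L(W,s)`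
continues `L(f, χ₋₈⁻¹, s)` (`χ₋₈⁻¹ = χ₋₈`, real values), and Birch's formula for the odd primitive `χ₋₈` (tree
`ratMinusTwistedSymbolSum_mul_minusPeriod_mul_I`) reads `(Σ_{a mod 8} χ₋₈(a)[a/8]⁻)·Ω⁻·i = τ(χ₋₈)·L(W, 1)` with
`Σ χ₋₈(a)[a/8]⁻ = [1/8]⁻ + [3/8]⁻ − [5/8]⁻ − [7/8]⁻` (`χ₋₈ = 1, 1, −1, −1` at `1, 3, 5, 7`) and `τ(χ₋₈) ≠ 0` (primitive).
[cite: MazurTateTeitelbaum1986Invent, §I.8 (8.6)] [cite: Cox2013, §1.C Lemma 1.14] [cite: SilvermanAEC2009, X.2 and Exercise 10.16] -/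
theorem ratMinusSymbolSum_eight_ne_zero_of_entireLFunction_ne_zero (hmod : hasEntireLFunction_rat)
    (hss : ∀ v : HeightOneSpectrum (𝓞 ℚ), (primesEquiv v : ℕ) = 2 → W''.IsSemistableAt v)
    (hL : W.entireLFunction 1 ≠ 0) :
    (ratMinusSymbol f (1 / 8) + ratMinusSymbol f (3 / 8) - ratMinusSymbol f (5 / 8) - ratMinusSymbol f (7 / 8) : ℚ)
      ≠ 0 := by
  obtain ⟨χ, hprim, hquad, hodd, hχ⟩ := exists_dirichletCharacter_neg_eight
  have hm4 : (-2 : ℤ) % 4 = 2 ∨ (-2 : ℤ) % 4 = 3 := Or.inl (by decide)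
  have hWtw' : ∃ C : VariableChange ℚ, C • W''.quadraticTwist ((-2 : ℤ) : ℚ) = W := by push_cast; exact hWtw
  -- (1) the Dirichlet coefficients of `W` are `χ(n) aₙ(f)`
  have hco : ∀ n : ℕ, ((W.LFunction n : ℤ) : ℂ) = χ n * cuspCoeff f n := by
    intro n
    rw [LFunction_eq_jacobiSym_mul_of_twist W W'' hm4 Int.prime_two.neg.squarefree hWtw'
      (isSemistableAt_of_dvd_four_mul W'' (Or.inr rfl) hss) n, hχ n, hf.2 n]
    split_ifs <;> push_cast <;> ring
  -- (2) `L(W, s) = L(f, χ⁻¹, s)` (`χ` quadratic: `χ⁻¹ = χ`) and its entire continuation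
  have hLS : ∀ s : ℂ, W.LSeries s = twistedLSeries f χ⁻¹ s := by
    intro s
    rw [hquad.inv]
    unfold WeierstrassCurve.LSeries twistedLSeries
    congr 1
    funext n
    exact hco n
  have hE : W.HasEntireLFunction := hmod W
  have hdiff : Differentiable ℂ W.entireLFunction := W.differentiable_entireLFunction hE
  have hL' : ∀ s : ℂ, 2 < s.re → W.entireLFunction s = twistedLSeries f χ⁻¹ s := fun s hs ↦ by
    rw [W.entireLFunction_eq_LSeries hE (by linarith), hLS]
  -- (3) Birch's formula for the odd primitive `χ`
  have hB := ratMinusTwistedSymbolSum_mul_minusPeriod_mul_I f hf.1 hf.coeffField_eq_bot hprim hodd hdiff hL'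
  have hχk : ∀ k : ℕ, χ (k : ZMod 8) = if Even k then 0 else (J(-2 | k) : ℂ) := fun k ↦ hχ k
  have hχ0 : χ 0 = 0 := by rw [← Nat.cast_zero, hχk 0]; simp
  have hχ1 : χ 1 = 1 := by rw [← Nat.cast_one, hχk 1]; simp [jacobiSym.one_right]
  have hχ2 : χ 2 = 0 := by rw [show (2 : ZMod 8) = ((2 : ℕ) : ZMod 8) by rfl, hχk 2, if_pos (by decide)]
  have hχ3 : χ 3 = 1 := by
    rw [show (3 : ZMod 8) = ((3 : ℕ) : ZMod 8) by rfl, hχk 3, if_neg (by decide)]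
    have : J(-2 | (3 : ℕ)) = 1 := by norm_num
    rw [this]; simp
  have hχ4 : χ 4 = 0 := by rw [show (4 : ZMod 8) = ((4 : ℕ) : ZMod 8) by rfl, hχk 4, if_pos (by decide)]
  have hχ5 : χ 5 = -1 := by
    rw [show (5 : ZMod 8) = ((5 : ℕ) : ZMod 8) by rfl, hχk 5, if_neg (by decide)]
    have : J(-2 | (5 : ℕ)) = -1 := by norm_num
    rw [this]; simp
  have hχ6 : χ 6 = 0 := by rw [show (6 : ZMod 8) = ((6 : ℕ) : ZMod 8) by rfl, hχk 6, if_pos (by decide)]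
  have hχ7 : χ 7 = -1 := by
    rw [show (7 : ZMod 8) = ((7 : ℕ) : ZMod 8) by rfl, hχk 7, if_neg (by decide)]
    have : J(-2 | (7 : ℕ)) = -1 := by norm_num
    rw [this]; simp
  have hv1 : (1 : ZMod 8).val = 1 := rfl
  have hv3 : (3 : ZMod 8).val = 3 := rfl
  have hv5 : (5 : ZMod 8).val = 5 := rfl
  have hv7 : (7 : ZMod 8).val = 7 := rfl
  have hsum : ratMinusTwistedSymbolSum f χ =
      ((ratMinusSymbol f (1 / 8) + ratMinusSymbol f (3 / 8) - ratMinusSymbol f (5 / 8) - ratMinusSymbol f (7 / 8) : ℚ)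
        : ℂ) := by
    rw [ratMinusTwistedSymbolSum, sum_univ_zmod_eight, hχ0, hχ1, hχ2, hχ3, hχ4, hχ5, hχ6, hχ7, hv1, hv3, hv5, hv7]
    push_cast
    ring_nf
  rw [hsum] at hB
  -- (4) `τ(χ₋₈) ≠ 0`
  have hτ := Literature.NumberTheory.LFunctions.gaussSum_ne_zero χ hprim
  intro hS
  rw [hS, Rat.cast_zero, zero_mul, zero_mul] at hB
  exact hL ((mul_eq_zero.mp hB.symm).resolve_left hτ)

variable (hsp : W''.HasSplitMultiplicativeReductionAtPrime 2)

include hWtw hsp hf in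
/-- **`L⁻₂(f_{W″}, 1, ω·χ₂, T) ≠ 0` whenever `L(W, 1) ≠ 0`**, for `W ≅ W″^{(−2)}` with `W″` SPLIT multiplicative at `2` and
`f` the newform of `W″`: the constant term of the `χ₂`-twisted odd branch of the one-term measure is
`[1/8]⁻ + [3/8]⁻ − [5/8]⁻ − [7/8]⁻` (`constantCoeff_padicLFunctionMinusBranchMultTwist_one_neg_one_two_of_split` — the
branch evaluated at the character `χ₂` of `Γ`), non-zero by Birch for `χ₋₈`.
[cite: MazurTateTeitelbaum1986Invent, §I.10 (10.1), §I.13–I.14, §I.8 (8.6)] -/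
theorem padicLFunctionMinusBranchMultTwist_ne_zero_of_entireLFunction_ne_zero (hmod : hasEntireLFunction_rat)
    (hL : W.entireLFunction 1 ≠ 0) : padicLFunctionMinusBranchMultTwist f (1 : ℚ_[2]) 1 (-1) ≠ 0 := by
  haveI : Fact (Nat.Prime 2) := ⟨Nat.prime_two⟩
  intro h0
  have hc := constantCoeff_padicLFunctionMinusBranchMultTwist_one_neg_one_two_of_split hf hsp
  rw [h0, map_zero] at hc
  have hq : (ratMinusSymbol f (1 / 8) + ratMinusSymbol f (3 / 8) - ratMinusSymbol f (5 / 8) - ratMinusSymbol f (7 / 8)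
      : ℚ) = 0 := by
    have h' : ((ratMinusSymbol f (1 / 8) + ratMinusSymbol f (3 / 8) - ratMinusSymbol f (5 / 8) -
        ratMinusSymbol f (7 / 8) : ℚ) : ℚ_[2]) = 0 := by
      push_cast; exact hc.symm
    exact_mod_cast h'
  exact ratMinusSymbolSum_eight_ne_zero_of_entireLFunction_ne_zero W W'' hWtw hf hmod
    (isSemistableAt_of_hasSplitMultiplicativeReductionAtPrime_two W'' hsp) hL hq

include hWtw hsp hf in
/-- **`∃ L̃ ∈ Λ` with `ι L̃ = 2⁰ · L⁻₂(f_{W″}, 1, ω·χ₂, T)` and `L̃ ≠ 0`** (`L(W,1) ≠ 0`): `L̃ := Tw₋₁ G`, the unit twist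
`(1+T) ↦ −(1+T)` of the integral lift `G` of the untwisted odd branch (`exists_iwasawa_lift_oddBranch`), has
`ι L̃ = L⁻₂(…, ω·ψ₋₁, T)` by GEN 2's `iwasawaToPowerSeries_unitTwist_eq_mul_padicLFunctionMinusBranchMultTwist_of_newform`
(`‖−1 − 1‖₂ < 1`), and is non-zero by `padicLFunctionMinusBranchMultTwist_ne_zero_of_entireLFunction_ne_zero`. The binder
`(Lt, m, hLt, hLt0)` of the (−2)-block print-level doors, SUPPLIED with `m = 0`.
[cite: MazurTateTeitelbaum1986Invent, §I.12–I.14] [cite: GreenbergLNM1716, §1 (pp. 67–68)] -/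
theorem exists_iwasawa_lift_oddBranchTwist_ne_zero (hmod : hasEntireLFunction_rat) (hL : W.entireLFunction 1 ≠ 0) :
    ∃ Lt : IwasawaAlgebra 2,
      iwasawaToPowerSeries 2 Lt =
          PowerSeries.C ((2 : ℚ_[2]) ^ (0 : ℕ)) * padicLFunctionMinusBranchMultTwist f (1 : ℚ_[2]) 1 (-1) ∧
        Lt ≠ 0 := by
  haveI : Fact (Nat.Prime 2) := ⟨Nat.prime_two⟩
  obtain ⟨G, hG⟩ := exists_iwasawa_lift_oddBranch W'' hf hsp
  have ha₂ : cuspCoeff f 2 = ((1 : ℤ) : ℂ) := by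
    rw [Int.cast_one]; exact (hf.cuspCoeff_eq_one_and_sq_of_split hsp).1
  have hε : ‖(-1 : ℤ_[2]) - 1‖ < 1 := by
    rw [show (-1 : ℤ_[2]) - 1 = -2 by norm_num, norm_neg]
    have h : ‖(2 : ℤ_[2])‖ = (2 : ℝ)⁻¹ := by
      have h' := PadicInt.norm_p (p := 2)
      simpa using h'
    rw [h]; norm_num
  have hG' : iwasawaToPowerSeries 2 G =
      PowerSeries.C (1 : ℚ_[2]) * padicLFunctionMinusBranchMult f ((1 : ℤ) : ℚ_[2]) 1 := by
    rw [hG, map_one, one_mul]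
  have htw := iwasawaToPowerSeries_unitTwist_eq_mul_padicLFunctionMinusBranchMultTwist_of_newform (p := 2) (i := 1) f
    hf.1 hf.coeffField_eq_bot (hf.dvd_level_of_split hsp) ha₂ (by norm_num) hε hG'
  rw [Int.cast_one, PadicInt.coe_neg, PadicInt.coe_one, map_one, one_mul] at htw
  refine ⟨PadicIntSeries.unitTwist G (-1), by rw [htw, pow_zero, map_one, one_mul], fun h0 ↦ ?_⟩
  rw [h0, map_zero] at htw
  exact padicLFunctionMinusBranchMultTwist_ne_zero_of_entireLFunction_ne_zero W W'' hWtw hf hsp hmod hL htw.symm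

end NegTwo

end Summit.BirchSwinnertonDyer.BirchSwinnertonDyer.Theorems.AddKatoTwo

end
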